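import Literature.NumberTheory.PAdicHodge.BmaxPlusThetaFrobeniusIterate
import Literature.NumberTheory.PAdicHodge.BmaxPlusTUnit
import Literature.NumberTheory.PAdicHodge.BmaxPlusFrobeniusImageInter
import Literature.NumberTheory.PAdicHodge.AinfThetaFrobeniusKernel
import Literature.NumberTheory.PAdicHodge.AinfRamifiedKernel
import HarnessLib

/-!
# `θ(φᵐ ξ_j) ≠ 0` for `m ≠ j`, `ω/ξ` is a unit of `𝔸_inf`, and `𝔸_inf → A_max` is injective

Topic `Literature/NumberTheory/PAdicHodge`; namespace `Literature.NumberTheory.PAdicHodge`. THEOREMS ONLY (no definition, no named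
fact, no instance). Three auxiliary facts for the `t`-divisibility theorem on Colmez's `A_max = B_max⁺(F)`:

* ★ `fontaineTheta_frobenius_iterate_xiM_ne_zero` — for a `pʲ`-th root `ϖ_j` of `p♭` and `ξ_j = [ϖ_j] − p`:
  **`θ(φᵐ ξ_j) = (ϖ_j♯)^{pᵐ} − p ≠ 0` whenever `m ≠ j`** (norms: `‖ϖ_j♯‖^{pʲ} = ‖p‖ < 1`); hence `ι(ξ_j)` (`j ≥ 1`) and `ι(φⁱξ)`
  (`i ≥ 1`) are non-zero-divisors on `A_max` (`BmaxPlusTRegular.eq_zero_of_mul_eq_zero_of_thetaBmaxPlus_ne_zero`);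
* ★ `isUnit_of_omega_eq_xi_mul` — **if `ω = ξ·c` then `c ∈ 𝔸_infˣ`**: `‖ω̄♯‖ = ‖(ε−1)♯‖/‖(ε^{1/p}−1)♯‖ = ‖p‖ = ‖(p♭)♯‖`, so `‖c̄♯‖ = 1`,
  `c̄ ∈ (𝒪♭)ˣ`, and units of `𝔸_inf` are detected modulo `p` (tree `Ainf.isUnit_of_isUnit_constantCoeff`);
* `ainfToBmaxPlus_injective` — **`ι : 𝔸_inf → A_max` is injective** (`𝔸_inf ∩ pᴺB⁰_max = (p,ξ)ᴺ` and `⋂ (p,ξ)ᴺ = 0`).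

Step (NV) of the `t`-divisibility theorem (TDIV) for `(A_max)^{φ=p} ∩ ker θ` (brick B7 of the φ-road of line `kato_lever`,
crux K★ `stmt-BirchSwinnertonDyer-22226`, memo `Cruxes/StarredOptimalManinUnitFiveSeven/Lines/kato-lever-K2-fontaine-lemma-g24.md`).
Infrastructure only: BSD / K★ are not proved by any of this.

## References
* [FontaineAsterisque223III] J.-M. Fontaine, *Le corps des périodes p-adiques*, Astérisque 223 (1994), Exp. II §1.2.2, §1.5.4 (`‖ω̄♯‖ = ‖p‖`).
* [Colmez1998Annals] P. Colmez, *Théorie d'Iwasawa des représentations de de Rham d'un corps local*, Ann. of Math. 148 (1998), §III.2.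
-/

noncomputable section

open WittVector Field ValuativeRel Polynomial Finset
open Literature.AlgebraicGeometry.Resolution

namespace Literature.NumberTheory.PAdicHodge

open Literature.NumberTheory.GaloisRepresentations
open Literature.NumberTheory.GaloisRepresentations.IsNonarchimedeanLocalField

variable {F : Type} [Field F] [ValuativeRel F] [TopologicalSpace F] [IsNonarchimedeanLocalField F]
  [CharZero F] {p : ℕ} [Fact p.Prime] [Fact (¬ IsUnit (p : integerC F))]
  [IsAdicComplete (Ideal.span {(p : integerC F)}) (integerC F)]

/-! ### `θ(φᵐ ξ_j) ≠ 0` for `m ≠ j` -/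

omit [CharZero F] in
/-- `θ(φᵐ([ϖ] − p)) = (ϖ♯)^{pᵐ} − p`. [cite: Colmez1998Annals, §III.2] -/
theorem fontaineTheta_frobenius_iterate_teichmuller_sub_natCast (m : ℕ) (ϖ : PreTilt (integerC F) p) :
    fontaineTheta (integerC F) p ((WittVector.frobenius : Ainf (p := p) F →+* Ainf (p := p) F)^[m]
      (teichmuller p ϖ - (p : Ainf (p := p) F))) = PreTilt.untilt ϖ ^ p ^ m - (p : integerC F) := by
  rw [iterate_map_sub, frobenius_iterate_teichmuller, frobenius_iterate_natCast, map_sub, map_pow, map_natCast,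
    fontaineTheta_teichmuller]

/-- ★ **`θ(φᵐ ξ_j) ≠ 0` for `m ≠ j`**, where `ξ_j = [ϖ_j] − p` with `ϖ_j^{pʲ} = p♭`: otherwise `(ϖ_j♯)^{pᵐ} = p`, and taking norms
(`‖ϖ_j♯‖^{pʲ} = ‖p‖`, `0 < ‖ϖ_j♯‖ < 1`) forces `pᵐ = pʲ`. [cite: Colmez1998Annals, §III.2] -/
theorem fontaineTheta_frobenius_iterate_xiM_ne_zero {j m : ℕ} {ϖm : PreTilt (integerC F) p} (hϖ : ϖm ^ p ^ j = pFlat) (hmj : m ≠ j) :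
    fontaineTheta (integerC F) p ((WittVector.frobenius : Ainf (p := p) F →+* Ainf (p := p) F)^[m]
      (teichmuller p ϖm - (p : Ainf (p := p) F))) ≠ 0 := by
  have hp := (Fact.out : p.Prime)
  rw [fontaineTheta_frobenius_iterate_teichmuller_sub_natCast, sub_ne_zero]
  intro h
  -- norms in `ℂ_F`
  set r : ℝ := ‖((PreTilt.untilt ϖm : integerC F) : CompletedAlgClosure F)‖ with hr
  have hj : r ^ p ^ j = ‖(p : CompletedAlgClosure F)‖ := by
    rw [hr, ← norm_pow, ← SubmonoidClass.coe_pow, ← map_pow, hϖ, untilt_pFlat, coe_natCast_integerC]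
  have hm : r ^ p ^ m = ‖(p : CompletedAlgClosure F)‖ := by
    rw [hr, ← norm_pow, ← SubmonoidClass.coe_pow, h, coe_natCast_integerC]
  have hlt : ‖(p : CompletedAlgClosure F)‖ < 1 := norm_natCast_C_lt_one'
  have hpos : 0 < ‖(p : CompletedAlgClosure F)‖ := norm_pos_iff.2 (natCast_C_ne_zero hp.ne_zero)
  have hr0 : 0 < r := by
    refine lt_of_le_of_ne (by rw [hr]; exact norm_nonneg _) fun h0 => ?_
    have hj' := hj
    rw [← h0, zero_pow (pow_ne_zero _ hp.ne_zero)] at hj'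
    exact hpos.ne hj'
  have hr1 : r ≠ 1 := fun h1 => by rw [h1, one_pow] at hj; exact hlt.ne hj.symm
  have hpow : p ^ m = p ^ j := pow_right_injective₀ hr0 hr1 (hm.trans hj.symm)
  exact hmj (Nat.pow_right_injective hp.two_le hpow)

/-- **`ι(ξ_j)` is a non-zero-divisor on `A_max` for `j ≥ 1`** (`θ(ξ_j) ≠ 0`). [cite: Colmez1998Annals, §III.2] -/
theorem eq_zero_of_xiM_mul_eq_zero (hF : Function.Surjective (fontaineTheta (integerC F) p)) {j : ℕ} {ϖm : PreTilt (integerC F) p}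
    (hϖ : ϖm ^ p ^ j = pFlat) (hj : j ≠ 0) {z : BmaxPlus F p}
    (hz : ainfToBmaxPlus F p (teichmuller p ϖm - (p : Ainf (p := p) F)) * z = 0) : z = 0 := by
  refine eq_zero_of_mul_eq_zero_of_thetaBmaxPlus_ne_zero hF ?_ hz
  rw [thetaBmaxPlus_ainfToBmaxPlus]
  have h := fontaineTheta_frobenius_iterate_xiM_ne_zero (m := 0) hϖ (Ne.symm hj)
  rwa [Function.iterate_zero, id] at h

/-- **`ι(φⁱ ξ)` is a non-zero-divisor on `A_max` for `i ≥ 1`** (`θ(φⁱξ) = p^{pⁱ} − p ≠ 0`). [cite: Colmez1998Annals, §III.2] -/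
theorem eq_zero_of_frobenius_iterate_xi_mul_eq_zero (hF : Function.Surjective (fontaineTheta (integerC F) p)) {i : ℕ} (hi : i ≠ 0)
    {z : BmaxPlus F p}
    (hz : ainfToBmaxPlus F p ((WittVector.frobenius : Ainf (p := p) F →+* Ainf (p := p) F)^[i] xi) * z = 0) : z = 0 := by
  refine eq_zero_of_mul_eq_zero_of_thetaBmaxPlus_ne_zero hF ?_ hz
  rw [thetaBmaxPlus_ainfToBmaxPlus, xi_def]
  exact fontaineTheta_frobenius_iterate_xiM_ne_zero (j := 0) (by rw [pow_zero, pow_one]) hi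

set_option maxHeartbeats 1600000 in
/-- **`ι(ξ) = p·(ξ/p)` is a non-zero-divisor on `A_max`.** [cite: Colmez1998Annals, §III.2] -/
theorem eq_zero_of_xi_mul_eq_zero (hF : Function.Surjective (fontaineTheta (integerC F) p)) {z : BmaxPlus F p}
    (hz : ainfToBmaxPlus F p xi * z = 0) : z = 0 := by
  rw [ainfToBmaxPlus_xi, mul_assoc] at hz
  exact eq_zero_of_omegaB_mul_eq_zero (eq_zero_of_natCast_mul_eq_zero' hF hz)

/-! ### `ω = ξ·c` with `c` a unit -/

set_option maxHeartbeats 800000 in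
/-- **`‖ω̄♯‖ = ‖p‖`** for Fontaine's `ω` (`ω̄ = ω mod p ∈ 𝒪♭`): `ω̄·(ε^{1/p} − 1) = ε − 1`, `‖(ε^{1/p}−1)♯‖^p = ‖(ε−1)♯‖` and
`‖(ε−1)♯‖^{p−1} = ‖p‖^p`. [cite: FontaineAsterisque223III, Exp. II §1.5.4] -/
theorem norm_untilt_constantCoeff_omega :
    ‖((PreTilt.untilt (WittVector.constantCoeff (omega : Ainf (p := p) F)) : integerC F) : CompletedAlgClosure F)‖ =
      ‖(p : CompletedAlgClosure F)‖ := by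
  have hp := (Fact.out : p.Prime)
  -- `ω̄ · (ε^{1/p} − 1) = ε − 1` in `𝒪♭`, with `ε^{1/p} − 1 = σ(ε − 1)`
  have hσ : (epsRoot : PreTilt (integerC F) p) - 1 = (frobeniusEquiv (PreTilt (integerC F) p) p).symm (eps - 1) := by
    rw [map_sub, map_one]; rfl
  have e0 : WittVector.constantCoeff (teichmuller p (epsRoot : PreTilt (integerC F) p) - 1 : Ainf (p := p) F) = epsRoot - 1 := by
    rw [map_sub, map_one, WittVector.constantCoeff_apply, teichmuller_coeff_zero]
  have h1 : WittVector.constantCoeff (omega : Ainf (p := p) F) * ((epsRoot : PreTilt (integerC F) p) - 1) = eps - 1 := by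
    rw [← constantCoeff_uAinf (F := F) (p := p), uAinf_eq_mul_omega, map_mul, e0, mul_comm]
  set A : ℝ := ‖((PreTilt.untilt ((eps : PreTilt (integerC F) p) - 1) : integerC F) : CompletedAlgClosure F)‖ with hA
  set B : ℝ := ‖((PreTilt.untilt ((epsRoot : PreTilt (integerC F) p) - 1) : integerC F) : CompletedAlgClosure F)‖ with hB
  set W : ℝ := ‖((PreTilt.untilt (WittVector.constantCoeff (omega : Ainf (p := p) F)) : integerC F) : CompletedAlgClosure F)‖ with hW
  have hBp : B ^ p = A := by
    have h := norm_untilt_frobeniusEquiv_symm_pow ((eps : PreTilt (integerC F) p) - 1) 1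
    rwa [pow_one, Function.iterate_one, ← hσ] at h
  have hAp : A ^ (p - 1) = ‖(p : CompletedAlgClosure F)‖ ^ p := norm_untilt_eps_sub_one_pow
  have hWB : W * B = A := by
    rw [hW, hB, hA, ← norm_mul, ← Subring.coe_mul, ← map_mul, h1]
  have hB0 : 0 < B := by
    rw [hB, norm_pos_iff]
    intro h
    have : A = 0 := by rw [← hBp, hB, h, norm_zero, zero_pow hp.ne_zero]
    rw [hA, norm_eq_zero] at this
    exact coe_untilt_eps_sub_one_ne_zero this
  -- `W = B^{p-1}` and `(B^{p-1})^p = ‖p‖^p`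
  have hp1 : p - 1 + 1 = p := Nat.sub_add_cancel hp.one_le
  have hW' : W = B ^ (p - 1) := by
    refine mul_right_cancel₀ hB0.ne' ?_
    rw [hWB, ← pow_succ, hp1, hBp]
  have h2 : (B ^ (p - 1)) ^ p = ‖(p : CompletedAlgClosure F)‖ ^ p := by
    rw [← pow_mul, mul_comm, pow_mul, hBp, hAp]
  rw [hW']
  exact (pow_left_inj₀ (pow_nonneg hB0.le _) (norm_nonneg _) hp.ne_zero).1 h2

set_option maxHeartbeats 800000 in
/-- ★ **If `ω = ξ·c` then `c` is a unit of `𝔸_inf`**: both `ω` and `ξ` generate `ker θ`. (Modulo `p`: `ω̄ = p♭·c̄` with `‖ω̄♯‖ = ‖p‖ = ‖(p♭)♯‖`,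
so `‖c̄♯‖ = 1` and `c̄` is a unit of the valuation ring `𝒪♭`.) [cite: FontaineAsterisque223III, Exp. II §1.5.4] -/
theorem isUnit_of_omega_eq_xi_mul {c : Ainf (p := p) F} (hc : omega = xi * c) : IsUnit c := by
  refine Ainf.isUnit_of_isUnit_constantCoeff (isUnit_of_norm_untilt_eq_one ?_)
  have h1 : WittVector.constantCoeff (omega : Ainf (p := p) F) = pFlat * WittVector.constantCoeff c := by
    rw [hc, map_mul, constantCoeff_xi]
  have h2 := norm_untilt_constantCoeff_omega (F := F) (p := p)
  rw [h1, map_mul, Subring.coe_mul, norm_mul, untilt_pFlat, coe_natCast_integerC] at h2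
  have hpos : 0 < ‖(p : CompletedAlgClosure F)‖ := norm_pos_iff.2 (natCast_C_ne_zero (Fact.out : p.Prime).ne_zero)
  have h3 : ‖(p : CompletedAlgClosure F)‖ * ‖((PreTilt.untilt (WittVector.constantCoeff c) : integerC F) : CompletedAlgClosure F)‖ =
      ‖(p : CompletedAlgClosure F)‖ * 1 := by rw [mul_one]; exact h2
  exact mul_left_cancel₀ hpos.ne' h3

/-! ### `𝔸_inf → A_max` is injective -/

set_option maxHeartbeats 800000 in
/-- **`ι : 𝔸_inf → A_max` is injective**: if `ι(a) = 0` then `a ∈ (p, ξ)ᴺ` for every `N` (`𝔸_inf ∩ pᴺB⁰_max = (p,ξ)ᴺ`), and `𝔸_inf` is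
`(p, ξ)`-adically separated. [cite: Colmez1998Annals, §III.2] -/
theorem ainfToBmaxPlus_injective (hF : Function.Surjective (fontaineTheta (integerC F) p)) :
    Function.Injective (ainfToBmaxPlus F p) := by
  refine (injective_iff_map_eq_zero _).2 fun a ha => ?_
  haveI := isAdicComplete_span_p_xi (F := F) (p := p)
  refine IsHausdorff.haus' (I := Ideal.span {(p : Ainf (p := p) F), xi}) a fun N => ?_
  rw [smul_eq_mul, Ideal.mul_top, SModEq.zero]
  refine mem_span_p_xi_pow_of_algebraMap_mem_pow hF N ?_
  have h := evalₐ_ainfToBmaxPlus (F := F) (p := p) N a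
  rw [ha, map_zero] at h
  exact (Ideal.Quotient.eq_zero_iff_mem).1 h.symm

end Literature.NumberTheory.PAdicHodge

end
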